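/-
Copyright (c) 2026. All rights reserved.
Released under Apache 2.0 license as described in the file LICENSE.
Authors: abc-iut cell, prover seat abc-iut-w5-d017 (wave 5, gen 6).
-/
import Summits.ABC.IUTFork.Cor312Ind3IteratesVacuityRamificationCriterion
import Literature.IUT.LogVolume.UnitLogDyadicFourthPowers
import HarnessLib

/-!
# (Ind3) honest iterates at DYADIC places with `f(v|2) = 1`: `4 ∤ e` ⇒ empty; `√−1 ∈ F`, `8 ∤ e` ⇒ empty

Proof-only sequel (theorems, no definitions) of abc-iut-w5-d017's `Cor312Ind3IteratesVacuityWildDyadicEmpty.lean`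
(`f(v|2) = 1`, `e(v|2) ≡ 2 (mod 4)` ⇒ empty) transporting the power criterion of
`Literature/IUT/LogVolume/UnitLogDyadicPowerCriterion.lean` / `UnitLogDyadicFourthPowers.lean` to the
completions `F_v` (abc-iut-S7: `e(F_v) = e(v|2)`, `f(F_v) = f(v|2)`):

* `Real.nonarchIterImage_add_two_eq_empty_of_not_four_dvd` — **`v ∣ 2`, `f(v|2) = 1`, `4 ∤ e(v|2)` ⇒ every
  honest depth-`≥ 2` image is EMPTY** (one statement for `e` odd and `e ≡ 2 (mod 4)`);
* `Real.nonarchIterImage_add_two_eq_empty_of_sq_eq_neg_one` — **`√−1 ∈ F`, `v ∣ 2`, `f(v|2) = 1`,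
  `8 ∤ e(v|2)` ⇒ EMPTY** — the clause relevant to [IUTchI] Def 3.1 data, where `√−1 ∈ F`: at such `v` with
  `e(v|2) ∈ {4, 12, 20, …}` nothing survives at depth `2`;
* packet-level forms `tprodImages_honestU_add_two_eq_empty_…`.

Dyadic census after this file (kernel, `f(v|2) = 1`): `4 ∤ e` ⇒ empty; `4 ∣ e` ⇒ FIELD-DEPENDENT in general
(`UnitLogDyadicQuarticFields.lean`: `ℚ₂(2^{1/4})` empty, `ℚ₂(α)`, `α⁴ + 2α² + 6 = 0` inhabited), but EMPTY
whenever `√−1 ∈ F` and `8 ∤ e`; `√−1 ∈ F`, `8 ∣ e`, `f = 1` — open here.  Honest framing: statements ABOUT THE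
MODEL; nothing here asserts or denies [IUTchIII] Cor. 3.12 or takes a side; census ≠ verdict; typed ≠ proved.
No definitions, no Prop-valued fact (D-0067 (1)).
-/

noncomputable section

open Set

namespace Summit.ABC.IUTFork.Thm311.Real

open NumberField IsDedekindDomain Literature.IUT.LogVolume Literature.IUT.LogThetaLattice
  Literature.NumberTheory.NumberFields

variable {F : Type} [Field F] [NumberField F]

/-! ### §1. `f(v|2) = 1`, `4 ∤ e(v|2)` -/

/-- Local step, `p`-indexed for transport: at a place over `p = 2` with `f(v|2) = 1`, `4 ∤ e(v|2)`, the
`2`-adic logarithm of no element of `F_v` has rescaled norm `1`. [cite: NeukirchANT1999, Ch. II (5.5)] -/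
theorem norm_unitLog_rescaled_ne_one_of_not_four_dvd (v : HeightOneSpectrum (𝓞 F)) (p : ℕ)
    [Fact p.Prime] (hv : ((p : ℕ) : 𝓞 F) ∈ v.asIdeal) (hp2 : p = 2)
    (he : ¬ 4 ∣ v.asIdeal.ramificationIdx ℤ) (hf : v.asIdeal.inertiaDeg ℤ = 1)
    (y : RescaledCompletion F p v hv) : ‖unitLog y‖ ≠ 1 := by
  subst hp2
  have he' : ¬ 4 ∣ absRamificationIdx 2 (RescaledCompletion F 2 v hv) := by
    rw [absRamificationIdx_rescaledCompletion]; exact he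
  have hf' : residueDegree 2 (RescaledCompletion F 2 v hv) = 1 := by
    rw [residueDegree_rescaledCompletion, hf]
  exact RamificationCriterion.norm_unitLog_ne_one_of_not_four_dvd hf' he' y

/-- **At `v ∣ 2` with `f(v|2) = 1`, `4 ∤ e(v|2)`: `‖log_v(w)‖' ≠ 1` for every unit `w ∈ O_v^×`.**
[cite: NeukirchANT1999, Ch. II (5.5)] -/
theorem norm_of_analyticLogv_ne_one_of_not_four_dvd (v : HeightOneSpectrum (𝓞 F))
    (h2 : residueChar F v = 2) (he : ¬ 4 ∣ v.asIdeal.ramificationIdx ℤ) (hf : v.asIdeal.inertiaDeg ℤ = 1)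
    (w : (↥(integers v))ˣ) :
    ‖RescaledCompletion.of F (residueChar F v) v (natCast_residueChar_mem F v)
        (analyticLogv F v (Additive.ofMul w))‖ ≠ 1 := by
  haveI : Fact (residueChar F v).Prime := ⟨residueChar_prime F v⟩
  rw [analyticLogv_apply, RingEquiv.apply_symm_apply]
  exact norm_unitLog_rescaled_ne_one_of_not_four_dvd v (residueChar F v)
    (natCast_residueChar_mem F v) h2 he hf _

/-- **… hence every honest (Ind3) iterate image of depth `m′ + 2` at such a dyadic place is EMPTY.**
[claim: Mochizuki2012, status: disputed] -/
theorem nonarchIterImage_add_two_eq_empty_of_not_four_dvd (v : HeightOneSpectrum (𝓞 F))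
    (h2 : residueChar F v = 2) (he : ¬ 4 ∣ v.asIdeal.ramificationIdx ℤ) (hf : v.asIdeal.inertiaDeg ℤ = 1)
    (m : ℕ) : nonarchIterImage (analyticLogv F) v (m + 2) = ∅ := by
  ext z
  simp only [mem_empty_iff_false, iff_false]
  rintro ⟨u, hu, -⟩
  obtain ⟨w, hw⟩ := nonarchIterImage_succ_subset_range (analyticLogv F) v m hu
  have h1 := norm_of_analyticLogv_ne_one_of_not_four_dvd v h2 he hf w
  dsimp only at hw
  rw [hw] at h1
  exact h1 (norm_of_coe_unit_adicCompletionIntegers F (residueChar F v) v (natCast_residueChar_mem F v) u)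

/-- The per-place honest family at depth `≥ 2` is empty at such a dyadic place.
[claim: Mochizuki2012, status: disputed] -/
theorem iterImage_add_two_inr_eq_empty_of_not_four_dvd (v : HeightOneSpectrum (𝓞 F))
    (h2 : residueChar F v = 2) (he : ¬ 4 ∣ v.asIdeal.ramificationIdx ℤ) (hf : v.asIdeal.inertiaDeg ℤ = 1)
    (m : ℕ) : iterImage (analyticLogv F) (m + 2) (.inr v : Place F) = ∅ :=
  nonarchIterImage_add_two_eq_empty_of_not_four_dvd v h2 he hf m

/-- **Packet level**: the pure-tensor unit image of the honest components at depth `m′ + 2` is EMPTY at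
`v_ℚ = 2` over which some place `w` of `F` has `f(w|2) = 1`, `4 ∤ e(w|2)`.
[claim: Mochizuki2012, status: disputed] -/
theorem tprodImages_honestU_add_two_eq_empty_of_not_four_dvd (X : PilotData F) (m : ℤ) (n : ℕ)
    (j : (thetaIndex X).Label) {vQ : (thetaIndex X).VQ}
    (w : HeightOneSpectrum (𝓞 F)) (hw : (thetaIndex X).over (.inr w) = vQ)
    (h2 : residueChar F w = 2) (he : ¬ 4 ∣ w.asIdeal.ramificationIdx ℤ) (hf : w.asIdeal.inertiaDeg ℤ = 1) :
    (logShellsDH X (analyticLogv F)).tprodImages j vQ (honestU X (analyticLogv F) m (n + 2) vQ) = ∅ :=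
  LogShells.tprodImages_eq_empty_of_eq_empty _ j vQ _ ⟨.inr w, hw⟩
    (nonarchIterImage_add_two_eq_empty_of_not_four_dvd w h2 he hf n)

/-! ### §2. `√−1 ∈ F`, `f(v|2) = 1`, `8 ∤ e(v|2)` -/

/-- Local step: `√−1 ∈ F`, a place over `p = 2` with `f(v|2) = 1`, `8 ∤ e(v|2)` ⇒ the `2`-adic logarithm of
no element of `F_v` has rescaled norm `1` (`√−1 ∈ F_v` via `F → F_v`). [cite: NeukirchANT1999, Ch. II (5.5)] -/
theorem norm_unitLog_rescaled_ne_one_of_sq_eq_neg_one (v : HeightOneSpectrum (𝓞 F)) (p : ℕ)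
    [Fact p.Prime] (hv : ((p : ℕ) : 𝓞 F) ∈ v.asIdeal) (hp2 : p = 2) {i : F} (hi : i ^ 2 = -1)
    (he : ¬ 8 ∣ v.asIdeal.ramificationIdx ℤ) (hf : v.asIdeal.inertiaDeg ℤ = 1)
    (y : RescaledCompletion F p v hv) : ‖unitLog y‖ ≠ 1 := by
  subst hp2
  have he' : ¬ 8 ∣ absRamificationIdx 2 (RescaledCompletion F 2 v hv) := by
    rw [absRamificationIdx_rescaledCompletion]; exact he
  have hf' : residueDegree 2 (RescaledCompletion F 2 v hv) = 1 := by
    rw [residueDegree_rescaledCompletion, hf]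
  have hiv : (RescaledCompletion.of F 2 v hv (algebraMap F (v.adicCompletion F) i)) ^ 2 = -1 := by
    rw [← map_pow, ← map_pow, hi, map_neg, map_one, map_neg, map_one]
  exact RamificationCriterion.norm_unitLog_ne_one_of_sq_eq_neg_one hf' hiv he' y

/-- **`√−1 ∈ F`, `v ∣ 2`, `f(v|2) = 1`, `8 ∤ e(v|2)`: `‖log_v(w)‖' ≠ 1` for every unit `w ∈ O_v^×`.**
[cite: NeukirchANT1999, Ch. II (5.5)] -/
theorem norm_of_analyticLogv_ne_one_of_sq_eq_neg_one (v : HeightOneSpectrum (𝓞 F))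
    (h2 : residueChar F v = 2) {i : F} (hi : i ^ 2 = -1) (he : ¬ 8 ∣ v.asIdeal.ramificationIdx ℤ)
    (hf : v.asIdeal.inertiaDeg ℤ = 1) (w : (↥(integers v))ˣ) :
    ‖RescaledCompletion.of F (residueChar F v) v (natCast_residueChar_mem F v)
        (analyticLogv F v (Additive.ofMul w))‖ ≠ 1 := by
  haveI : Fact (residueChar F v).Prime := ⟨residueChar_prime F v⟩
  rw [analyticLogv_apply, RingEquiv.apply_symm_apply]
  exact norm_unitLog_rescaled_ne_one_of_sq_eq_neg_one v (residueChar F v)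
    (natCast_residueChar_mem F v) h2 hi he hf _

/-- **`√−1 ∈ F` ⇒ every honest (Ind3) iterate image of depth `m′ + 2` at a place `v ∣ 2` with `f(v|2) = 1`,
`8 ∤ e(v|2)` is EMPTY** (e.g. `e(v|2) = 4` or `12`). [claim: Mochizuki2012, status: disputed] -/
theorem nonarchIterImage_add_two_eq_empty_of_sq_eq_neg_one (v : HeightOneSpectrum (𝓞 F))
    (h2 : residueChar F v = 2) {i : F} (hi : i ^ 2 = -1) (he : ¬ 8 ∣ v.asIdeal.ramificationIdx ℤ)
    (hf : v.asIdeal.inertiaDeg ℤ = 1) (m : ℕ) : nonarchIterImage (analyticLogv F) v (m + 2) = ∅ := by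
  ext z
  simp only [mem_empty_iff_false, iff_false]
  rintro ⟨u, hu, -⟩
  obtain ⟨w, hw⟩ := nonarchIterImage_succ_subset_range (analyticLogv F) v m hu
  have h1 := norm_of_analyticLogv_ne_one_of_sq_eq_neg_one v h2 hi he hf w
  dsimp only at hw
  rw [hw] at h1
  exact h1 (norm_of_coe_unit_adicCompletionIntegers F (residueChar F v) v (natCast_residueChar_mem F v) u)

/-- The per-place honest family at depth `≥ 2` is empty there. [claim: Mochizuki2012, status: disputed] -/
theorem iterImage_add_two_inr_eq_empty_of_sq_eq_neg_one (v : HeightOneSpectrum (𝓞 F))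
    (h2 : residueChar F v = 2) {i : F} (hi : i ^ 2 = -1) (he : ¬ 8 ∣ v.asIdeal.ramificationIdx ℤ)
    (hf : v.asIdeal.inertiaDeg ℤ = 1) (m : ℕ) : iterImage (analyticLogv F) (m + 2) (.inr v : Place F) = ∅ :=
  nonarchIterImage_add_two_eq_empty_of_sq_eq_neg_one v h2 hi he hf m

/-- **Packet level**: `√−1 ∈ F` ⇒ the pure-tensor unit image of the honest components at depth `m′ + 2` is
EMPTY at `v_ℚ = 2` over which some place `w` of `F` has `f(w|2) = 1`, `8 ∤ e(w|2)`.
[claim: Mochizuki2012, status: disputed] -/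
theorem tprodImages_honestU_add_two_eq_empty_of_sq_eq_neg_one (X : PilotData F) (m : ℤ) (n : ℕ)
    (j : (thetaIndex X).Label) {vQ : (thetaIndex X).VQ}
    (w : HeightOneSpectrum (𝓞 F)) (hw : (thetaIndex X).over (.inr w) = vQ)
    (h2 : residueChar F w = 2) {i : F} (hi : i ^ 2 = -1) (he : ¬ 8 ∣ w.asIdeal.ramificationIdx ℤ)
    (hf : w.asIdeal.inertiaDeg ℤ = 1) :
    (logShellsDH X (analyticLogv F)).tprodImages j vQ (honestU X (analyticLogv F) m (n + 2) vQ) = ∅ :=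
  LogShells.tprodImages_eq_empty_of_eq_empty _ j vQ _ ⟨.inr w, hw⟩
    (nonarchIterImage_add_two_eq_empty_of_sq_eq_neg_one w h2 hi he hf n)

end Summit.ABC.IUTFork.Thm311.Real

end
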